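import Mathlib.Analysis.SpecialFunctions.Pow.Real
import Literature.Barriers.CriticalPhenomena.WeaklySAWCouplingFlowCutoff
import HarnessLib

/-!
# [BBS-rg-flow, Lemma 2.1]: monotonicity of `ḡ` in `β` and the decay estimate (ii)(b)
# `χ_jḡ_jⁿ ≤ C_n (ḡ₀/(1+ḡ₀j))ⁿ`

Third file of the series formalising [BBS-rg-flow] (Bauerschmidt–Brydges–Slade, AHP 16 (2015),
arXiv:1211.2477) towards BBS 2015, Theorem 7.2.1 / Theorem 4.1 and
`Literature.Barriers.CriticalPhenomena.WeaklySAWFourDimLogCorrections`; continuation of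
`WeaklySAWCouplingFlowCutoff.lean` (hypotheses `CutoffGbarHyp β Ω k B c N g₀`: Assumption (A1) for an
arbitrary cut-off `k`, exceptional scales, explicit smallness of `g₀`).

Proved here, following the printed proof of Lemma 2.1(ii)(b) line by line:
* the comparison principle behind "`ḡ_j` is non-increasing in `β_k`" (Lemma 2.1(i), last assertion):
  `gbar_le_gbar_of_beta_le` (if `β' ≤ β` on `[0,n)` and the flows stay in the regime
  `β'_l(ḡ'_l + ḡ_l) ≤ 1`, then `ḡ_n(β) ≤ ḡ_n(β')`), from the one-step identity
  `gbar_sub_gbar_succ_of_beta`;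
* the two comparison sequences of the proof: `β̃_j = min{c, β_j}` (`CutoffGbarHyp.truncate`: same
  hypotheses) and `β ≡ c` (`CutoffGbarHyp.const`), with `ḡ_j ≤ g̃_j` and `ĝ_j ≤ g̃_j` ((2.11),
  `gbar_le_gbar_truncate`, `gbar_const_le_gbar_truncate`), `ĝ_j ≤ g₀/(1+cg₀j)` (Example 1.1(i),
  `gbar_const_le`), and the key step (2.12) `g̃_j ≤ ĝ_j ∏_{exceptional l<j}(1+O(g₀)) ≤ 2ĝ_j` below the
  cut-off (`gbar_truncate_le_const_mul`, `gbar_le_of_below_cutoff`);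
* (ii)(b), (2.10): `Ω^{-(j-k)₊}ḡ_jⁿ ≤ 4ⁿ max{1, A_n(Ω)} (g₀/(1+cg₀j))ⁿ ≤ C_n (g₀/(1+g₀j))ⁿ` for real
  `n ≥ 1` and ALL `j` (`weight_mul_gbar_rpow_le`, `chi_mul_gbar_rpow_le`), where beyond the cut-off
  the geometric weight beats the polynomial loss through `mⁿΩ^{-m} ≤ A_n(Ω) = (Ω^{1/⌈n⌉}-1)^{-⌈n⌉}`
  (`decayConst`, `rpow_mul_inv_pow_le_decayConst`, Bernoulli); `C_n = 4ⁿmax{1,A_n(Ω)}max{1,c⁻¹}ⁿ`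
  depends only on `n, Ω, c`, and the smallness of `g₀` (`cg₀ ≤ 1/4`, `2N(2B+c)g₀ ≤ 1/2` on top of
  `CutoffGbarHyp`) does not depend on `n` — as required by Proposition 1.2 ("valid for real
  `n ∈ [1,∞)` with an `n`-dependent constant").

Deliberately NOT here: Lemma 2.1(iii)(a) for general `γ` and (iv) (next files, with Lemma 2.3), and
Lemma 2.2 / Proposition 1.2 (next file).

## References
* R. Bauerschmidt, D. C. Brydges, G. Slade, *Structural stability of a dynamical system near a
  non-hyperbolic fixed point*, Ann. Henri Poincaré 16 (2015), arXiv:1211.2477: Example 1.1(i),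
  Lemma 2.1(i) (monotonicity), (ii)(b) (2.10)–(2.12) and proof. [BauerschmidtBrydgesSlade2015Flow]
* R. Bauerschmidt, D. C. Brydges, G. Slade, CMP 337 (2015), Proposition 6.1.1 (first estimate).
  [BauerschmidtBrydgesSlade2015LogCorr]
-/

noncomputable section

open Filter Topology Set
open scoped BigOperators

namespace Literature.Barriers.CriticalPhenomena

namespace CTWSAW

/-! ## [BBS-rg-flow, Lemma 2.1(i) (monotonicity in `β`) and (ii)(b)] -/

/-! ### Comparison of two flows with ordered `β`'s -/

/-- One step of the comparison of two flows with the same initial condition: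
`ḡ'_{l+1} - ḡ_{l+1} = (ḡ'_l - ḡ_l)(1 - β'_l(ḡ'_l + ḡ_l)) + (β_l - β'_l)ḡ_l²` for `ḡ = ḡ(β)`, `ḡ' = ḡ(β')`.
[cite: BauerschmidtBrydgesSlade2015Flow, Lemma 2.1(i) (monotonicity of ḡ_j in β_k) and (iv), (2.8)] -/
theorem gbar_sub_gbar_succ_of_beta (β β' : ℕ → ℝ) (g₀ : ℝ) (l : ℕ) :
    gbar β' g₀ (l + 1) - gbar β g₀ (l + 1) =
      (gbar β' g₀ l - gbar β g₀ l) * (1 - β' l * (gbar β' g₀ l + gbar β g₀ l)) +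
        (β l - β' l) * gbar β g₀ l ^ 2 := by
  rw [gbar_succ, gbar_succ]; ring

/-- **Monotonicity of `ḡ_n` in `β`** (Lemma 2.1(i), last assertion, in comparison form): if
`β'_l ≤ β_l` for `l < n` and the flows stay in the regime `β'_l(ḡ'_l + ḡ_l) ≤ 1`, `ḡ_l ≥ 0`, then
`ḡ_n(β) ≤ ḡ_n(β')`. [cite: BauerschmidtBrydgesSlade2015Flow, Lemma 2.1(i) ("for all j and k, ḡ_j is non-increasing in β_k")] -/
theorem gbar_le_gbar_of_beta_le {β β' : ℕ → ℝ} {g₀ : ℝ} (n : ℕ) (hle : ∀ l < n, β' l ≤ β l)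
    (hreg : ∀ l < n, β' l * (gbar β' g₀ l + gbar β g₀ l) ≤ 1) :
    gbar β g₀ n ≤ gbar β' g₀ n := by
  induction n with
  | zero => simp
  | succ n ih =>
    have ih' := ih (fun l hl => hle l (Nat.lt_succ_of_lt hl)) fun l hl => hreg l (Nat.lt_succ_of_lt hl)
    have h1 := hle n (Nat.lt_succ_self n)
    have h2 := hreg n (Nat.lt_succ_self n)
    have key := gbar_sub_gbar_succ_of_beta β β' g₀ n
    nlinarith [sq_nonneg (gbar β g₀ n), mul_nonneg (sub_nonneg.2 ih') (sub_nonneg.2 h2),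
      mul_nonneg (sub_nonneg.2 h1) (sq_nonneg (gbar β g₀ n))]

namespace CutoffGbarHyp

variable {β : ℕ → ℝ} {Ω : ℝ} {k : ℕ∞} {B c : ℝ} {N : ℕ} {g₀ : ℝ} (h : CutoffGbarHyp β Ω k B c N g₀)
include h

/-- The truncated sequence `β̃_j = min{c, β_j}` of the proof of Lemma 2.1(ii)(b) again satisfies the
hypotheses (same cut-off, constants and exceptional scales).
[cite: BauerschmidtBrydgesSlade2015Flow, Lemma 2.1(ii)(b) (proof, the sequence β̃)] -/
theorem truncate : CutoffGbarHyp (fun j => min c (β j)) Ω k B c N g₀ := by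
  obtain ⟨s, hsN, hs⟩ := h.exc
  refine ⟨h.one_lt, fun j => ?_, h.c_pos, ⟨s, hsN, fun j hj hjs => ?_⟩, h.g₀_pos, h.g₀_le, h.smallB,
    h.smallN⟩
  · refine le_trans ?_ (h.abs_le j)
    rcases le_total c (β j) with hcj | hcj
    · rw [min_eq_left hcj, abs_of_pos h.c_pos]
      exact hcj.trans (le_abs_self _)
    · rw [min_eq_right hcj]
  · exact le_min le_rfl (hs j hj hjs)

/-- The constant sequence `β ≡ c` satisfies the hypotheses (no exceptional scales, cut-off `∞`, and,
the weights being then irrelevant, `Ω = 2`), provided `cg₀ ≤ 1/4`. [cite: BauerschmidtBrydgesSlade2015Flow, Lemma 2.1(ii)(b) (proof, the sequence ĝ)] -/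
theorem const (hc : c * g₀ ≤ 1 / 4) : CutoffGbarHyp (fun _ => c) 2 ⊤ c c 0 g₀ := by
  refine ⟨one_lt_two, fun j => by simp [abs_of_pos h.c_pos], h.c_pos,
    ⟨∅, by simp, fun j _ _ => le_rfl⟩, h.g₀_pos, h.g₀_le, hc, ?_⟩
  norm_num
  nlinarith [mul_pos h.c_pos h.g₀_pos]

/-- `ḡ_j ≤ g̃_j`: truncating `β` at `c` from above can only increase the flow.
[cite: BauerschmidtBrydgesSlade2015Flow, Lemma 2.1(ii)(b) (proof, (2.9): ḡ_j ≤ g̃_j)] -/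
theorem gbar_le_gbar_truncate (j : ℕ) : gbar β g₀ j ≤ gbar (fun j => min c (β j)) g₀ j := by
  have ht := h.truncate
  refine gbar_le_gbar_of_beta_le j (fun l _ => min_le_right _ _) fun l _ => ?_
  have h1 := ht.abs_le_B l; have h2 := ht.gbar_le_two_mul_init l; have h3 := h.gbar_le_two_mul_init l
  have h4 := ht.gbar_pos l; have h5 := h.gbar_pos l
  calc min c (β l) * (gbar (fun j => min c (β j)) g₀ l + gbar β g₀ l)
      ≤ |min c (β l)| * (gbar (fun j => min c (β j)) g₀ l + gbar β g₀ l) :=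
        mul_le_mul_of_nonneg_right (le_abs_self _) (by linarith)
    _ ≤ B * (2 * g₀ + 2 * g₀) := mul_le_mul h1 (by linarith) (by linarith) h.B_nonneg
    _ ≤ 1 := by linarith [h.smallB]

/-- `ĝ_j ≤ g̃_j`: the flow with `β ≡ c ≥ β̃` is below the truncated flow.
[cite: BauerschmidtBrydgesSlade2015Flow, Lemma 2.1(ii)(b) (proof, (2.9): ĝ_j ≤ g̃_j)] -/
theorem gbar_const_le_gbar_truncate (hc : c * g₀ ≤ 1 / 4) (j : ℕ) :
    gbar (fun _ => c) g₀ j ≤ gbar (fun j => min c (β j)) g₀ j := by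
  have ht := h.truncate
  have hk := h.const hc
  refine gbar_le_gbar_of_beta_le j (fun l _ => min_le_left _ _) fun l _ => ?_
  have h1 := ht.abs_le_B l; have h2 := ht.gbar_le_two_mul_init l; have h3 := hk.gbar_le_two_mul_init l
  have h4 := ht.gbar_pos l; have h5 := hk.gbar_pos l
  calc min c (β l) * (gbar (fun j => min c (β j)) g₀ l + gbar (fun _ => c) g₀ l)
      ≤ |min c (β l)| * (gbar (fun j => min c (β j)) g₀ l + gbar (fun _ => c) g₀ l) :=
        mul_le_mul_of_nonneg_right (le_abs_self _) (by linarith)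
    _ ≤ B * (2 * g₀ + 2 * g₀) := mul_le_mul h1 (by linarith) (by linarith) h.B_nonneg
    _ ≤ 1 := by linarith [h.smallB]

/-- The flow with constant `β ≡ c`: `ĝ_j ≤ g₀/(1 + cg₀j)` (Example 1.1(i); from
`ĝ_k⁻¹ ≥ g₀⁻¹ + Σ_{j<k} c` of `WeaklySAWCouplingFlow.lean`).
[cite: BauerschmidtBrydgesSlade2015Flow, Example 1.1(i) and Lemma 2.1(ii)(b) (proof: ĝ_j ∼ ĝ₀/(1 + cĝ₀j))] -/
theorem gbar_const_le (hc : c * g₀ ≤ 1 / 4) (j : ℕ) : gbar (fun _ => c) g₀ j ≤ g₀ / (1 + c * g₀ * j) := by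
  have hG : GbarHyp (fun _ => c) c g₀ := ⟨fun _ => h.c_pos.le, fun _ => le_rfl, h.g₀_pos, hc⟩
  have := hG.gbar_le_of_sum j
  simp only [Finset.sum_const, Finset.card_range, nsmul_eq_mul] at this
  convert this using 2; ring

/-- The heart of the proof of (ii)(b): below the cut-off, `g̃_j ≤ ĝ_j F^{#bad scales < j}` with
`F = (1 + 2Bg₀)/(1 - cg₀)`, by induction on `j` (on a good scale `β̃_l = c` and `1 - cg̃_l ≤ 1 - cĝ_l`;
an exceptional scale costs at most a factor `F`).
[cite: BauerschmidtBrydgesSlade2015Flow, Lemma 2.1(ii)(b) (proof, the two displays after (2.9))] -/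
theorem gbar_truncate_le_const_mul (hc : c * g₀ ≤ 1 / 4) {s : Finset ℕ}
    (hs : ∀ j : ℕ, (j : ℕ∞) ≤ k → j ∉ s → c ≤ β j) (j : ℕ) (hj : ∀ l < j, (l : ℕ∞) ≤ k) :
    gbar (fun j => min c (β j)) g₀ j ≤
      gbar (fun _ => c) g₀ j * ((1 + 2 * B * g₀) / (1 - c * g₀)) ^ (s.filter (· < j)).card := by
  classical
  have ht := h.truncate
  have hk := h.const hc
  set F : ℝ := (1 + 2 * B * g₀) / (1 - c * g₀) with hF
  have hB := h.B_nonneg; have hg₀ := h.g₀_pos; have hcp := h.c_pos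
  have hden : 0 < 1 - c * g₀ := by linarith
  have hF1 : 1 ≤ F := by rw [hF, le_div_iff₀ hden]; nlinarith
  induction j with
  | zero => simp
  | succ j ih =>
    have ih' := ih fun l hl => hj l (Nat.lt_succ_of_lt hl)
    have hjk : (j : ℕ∞) ≤ k := hj j (Nat.lt_succ_self j)
    have hgt := ht.gbar_pos j; have hgk := hk.gbar_pos j
    have hgt2 := ht.gbar_le_two_mul_init j; have hgk2 := hk.gbar_le_two_mul_init j
    have hFpow : 0 ≤ F ^ (s.filter (· < j)).card := by positivity
    rw [gbar_succ' (fun j => min c (β j)), gbar_succ' (fun _ => c)]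
    by_cases hjs : j ∈ s
    · -- exceptional scale: lose a factor `F`
      have hcard : (s.filter (· < j + 1)).card = (s.filter (· < j)).card + 1 := by
        have : s.filter (· < j + 1) = insert j (s.filter (· < j)) := by
          ext l; simp only [Finset.mem_filter, Finset.mem_insert, Nat.lt_succ_iff]
          constructor
          · rintro ⟨hl, hlj⟩
            rcases hlj.lt_or_eq with h' | h'
            · exact Or.inr ⟨hl, h'⟩
            · exact Or.inl h'
          · rintro (rfl | ⟨hl, hlj⟩)
            · exact ⟨hjs, le_rfl⟩
            · exact ⟨hl, hlj.le⟩
        rw [this, Finset.card_insert_of_notMem (by simp)]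
      rw [hcard, pow_succ]
      -- `g̃_j(1 - β̃_jg̃_j) ≤ g̃_j(1 + 2Bg₀)` and `ĝ_j ≤ ĝ_j(1 - cĝ_j)/(1 - cg₀)`
      have h1 : 1 - min c (β j) * gbar (fun j => min c (β j)) g₀ j ≤ 1 + 2 * B * g₀ := by
        have := ht.abs_beta_mul_gbar_le j
        have hw := ht.weight_le_one j
        have : |min c (β j)| * gbar (fun j => min c (β j)) g₀ j ≤ 2 * B * g₀ := by
          calc _ ≤ 2 * B * g₀ * cutoffWeight Ω k j := this
            _ ≤ 2 * B * g₀ := mul_le_of_le_one_right (by positivity) hw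
        nlinarith [neg_abs_le (min c (β j)), hgt.le,
          mul_le_mul_of_nonneg_right (neg_abs_le (min c (β j))) hgt.le]
      have h2 : 1 - c * g₀ ≤ 1 - c * gbar (fun _ => c) g₀ j := by
        have : gbar (fun _ => c) g₀ j ≤ g₀ := by
          have hG : GbarHyp (fun _ => c) c g₀ := ⟨fun _ => hcp.le, fun _ => le_rfl, hg₀, hc⟩
          exact hG.gbar_le_init j
        nlinarith
      have hFd : (1 - c * g₀) * F = 1 + 2 * B * g₀ := by
        rw [hF]; field_simp
      calc gbar (fun j => min c (β j)) g₀ j * (1 - min c (β j) * gbar (fun j => min c (β j)) g₀ j)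
          ≤ (gbar (fun _ => c) g₀ j * F ^ (s.filter (· < j)).card) * (1 + 2 * B * g₀) :=
            mul_le_mul ih' h1 (by linarith [(ht.one_sub_mem j).1]) (by positivity)
        _ = gbar (fun _ => c) g₀ j * (1 - c * g₀) * (F ^ (s.filter (· < j)).card * F) := by
            rw [← hFd]; ring
        _ ≤ gbar (fun _ => c) g₀ j * (1 - c * gbar (fun _ => c) g₀ j) *
              (F ^ (s.filter (· < j)).card * F) := by
            gcongr
    · -- good scale: `β̃_j = c`, `1 - cg̃_j ≤ 1 - cĝ_j`
      have hβ : min c (β j) = c := min_eq_left (hs j hjk hjs)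
      have hcard : (s.filter (· < j + 1)).card = (s.filter (· < j)).card := by
        congr 1; ext l
        simp only [Finset.mem_filter, Nat.lt_succ_iff]
        constructor
        · rintro ⟨hl, hlj⟩
          exact ⟨hl, lt_of_le_of_ne hlj (by rintro rfl; exact hjs hl)⟩
        · rintro ⟨hl, hlj⟩; exact ⟨hl, hlj.le⟩
      rw [hcard, hβ]
      have hcomp := h.gbar_const_le_gbar_truncate hc j
      have h3 : 1 - c * gbar (fun j => min c (β j)) g₀ j ≤ 1 - c * gbar (fun _ => c) g₀ j := by
        nlinarith
      have h4 : 0 ≤ 1 - c * gbar (fun j => min c (β j)) g₀ j := by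
        have := (ht.one_sub_mem j).1; rw [hβ] at this; linarith
      calc gbar (fun j => min c (β j)) g₀ j * (1 - c * gbar (fun j => min c (β j)) g₀ j)
          ≤ (gbar (fun _ => c) g₀ j * F ^ (s.filter (· < j)).card) *
              (1 - c * gbar (fun _ => c) g₀ j) := mul_le_mul ih' h3 h4 (by positivity)
        _ = gbar (fun _ => c) g₀ j * (1 - c * gbar (fun _ => c) g₀ j) * F ^ (s.filter (· < j)).card := by
            ring

/-- Below the cut-off, `ḡ_j ≤ 2g₀/(1 + cg₀j)`: the bound (2.12) `ḡ_j ≤ (1+O(g₀))ĝ_j` with the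
exceptional product bounded by `2` (smallness `2N(2B + c)g₀ ≤ 1/2`).
[cite: BauerschmidtBrydgesSlade2015Flow, Lemma 2.1(ii)(b) (proof, (2.10) and (2.12))] -/
theorem gbar_le_of_below_cutoff (hc : c * g₀ ≤ 1 / 4) (hsmall3 : 2 * N * (2 * B + c) * g₀ ≤ 1 / 2)
    (j : ℕ) (hj : ∀ l < j, (l : ℕ∞) ≤ k) : gbar β g₀ j ≤ 2 * (g₀ / (1 + c * g₀ * j)) := by
  classical
  obtain ⟨s, hsN, hs⟩ := h.exc
  have hB := h.B_nonneg; have hg₀ := h.g₀_pos; have hcp := h.c_pos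
  have hden : 0 < 1 - c * g₀ := by linarith
  set F : ℝ := (1 + 2 * B * g₀) / (1 - c * g₀) with hF
  have h1 := h.gbar_le_gbar_truncate j
  have h2 := h.gbar_truncate_le_const_mul hc hs j hj
  have h3 := h.gbar_const_le hc j
  have hĝ := (h.const hc).gbar_pos j
  -- the exceptional product: `F^{#} ≤ F^N ≤ (1 + a)^N ≤ (1 - Na)⁻¹ ≤ 2`, `a = (4B + 2c)g₀`
  set a : ℝ := (4 * B + 2 * c) * g₀ with ha
  have ha0 : 0 ≤ a := by positivity
  have hF1 : 1 ≤ F := by rw [hF, le_div_iff₀ hden]; nlinarith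
  have hFa : F ≤ 1 + a := by
    rw [hF, div_le_iff₀ hden]
    nlinarith [mul_nonneg hB hg₀.le, mul_nonneg hcp.le hg₀.le, mul_nonneg (mul_nonneg hB hg₀.le) (mul_nonneg hcp.le hg₀.le)]
  have hpow : F ^ (s.filter (· < j)).card ≤ 2 := by
    have hcardN : (s.filter (· < j)).card ≤ N := (Finset.card_filter_le _ _).trans hsN
    calc F ^ (s.filter (· < j)).card ≤ F ^ N := pow_le_pow_right₀ hF1 hcardN
      _ ≤ (1 + a) ^ N := pow_le_pow_left₀ (by linarith) hFa N
      _ = ∏ _i ∈ Finset.range N, (1 + a) := by simp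
      _ ≤ (1 - ∑ _i ∈ Finset.range N, a)⁻¹ :=
          prod_one_add_le_inv_one_sub_sum _ _ (fun _ _ => ha0) (by
            simp only [Finset.sum_const, Finset.card_range, nsmul_eq_mul]; nlinarith)
      _ ≤ 2 := by
          simp only [Finset.sum_const, Finset.card_range, nsmul_eq_mul]
          rw [inv_le_comm₀ (by nlinarith) two_pos]; nlinarith
  calc gbar β g₀ j ≤ gbar (fun j => min c (β j)) g₀ j := h1
    _ ≤ gbar (fun _ => c) g₀ j * F ^ (s.filter (· < j)).card := h2
    _ ≤ g₀ / (1 + c * g₀ * j) * 2 := mul_le_mul h3 hpow (by positivity) (by positivity)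
    _ = 2 * (g₀ / (1 + c * g₀ * j)) := by ring

end CutoffGbarHyp


/-! ### [BBS-rg-flow, Lemma 2.1(ii)(b)]: `χ_jḡ_jⁿ ≤ C_n (ḡ₀/(1+ḡ₀j))ⁿ` -/

/-- `m ≤ ρᵐ/(ρ - 1)` for `ρ > 1` (Bernoulli). [folklore] -/
theorem natCast_le_pow_div_sub_one {ρ : ℝ} (hρ : 1 < ρ) (m : ℕ) : (m : ℝ) ≤ ρ ^ m / (ρ - 1) := by
  have hb := one_add_mul_le_pow (show (-2 : ℝ) ≤ ρ - 1 by linarith) m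
  rw [add_sub_cancel] at hb
  rw [le_div_iff₀ (by linarith)]
  linarith

/-- The constant `A_n(Ω) = (Ω^{1/⌈n⌉} - 1)^{-⌈n⌉}` bounding `mⁿΩ^{-m}`, `m ∈ ℕ`.
[cite: BauerschmidtBrydgesSlade2015Flow, Lemma 2.1(ii)(b) (proof, the case j > j_Ω: "Ω⁻¹ ≤ (1 - cḡ₀)ⁿ")] -/
def decayConst (Ω n : ℝ) : ℝ := ((Ω ^ (1 / (⌈n⌉₊ : ℝ)) - 1)⁻¹) ^ ⌈n⌉₊

/-- `mⁿ Ω^{-m} ≤ A_n(Ω)` for all `m ∈ ℕ` (`Ω > 1`, real `n ≥ 1`): polynomial growth against geometric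
decay, with a constant depending only on `n` and `Ω`. [folklore] -/
theorem rpow_mul_inv_pow_le_decayConst {Ω : ℝ} (hΩ : 1 < Ω) {n : ℝ} (hn : 1 ≤ n) (m : ℕ) :
    (m : ℝ) ^ n * (Ω ^ m)⁻¹ ≤ decayConst Ω n := by
  set p : ℕ := ⌈n⌉₊ with hp
  have hp1 : 1 ≤ p := Nat.one_le_iff_ne_zero.2 (by
    rw [hp]; exact Nat.pos_iff_ne_zero.1 (Nat.ceil_pos.2 (by linarith)))
  have hpn : n ≤ p := Nat.le_ceil n
  have hp0 : (0 : ℝ) < p := by exact_mod_cast hp1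
  set ρ : ℝ := Ω ^ (1 / (p : ℝ)) with hρ
  have hΩ0 : 0 < Ω := by linarith
  have hρ1 : 1 < ρ := Real.one_lt_rpow hΩ (by positivity)
  have hρpow : ρ ^ p = Ω := by
    rw [hρ, ← Real.rpow_natCast, ← Real.rpow_mul hΩ0.le, one_div_mul_cancel hp0.ne', Real.rpow_one]
  have hA : decayConst Ω n = ((ρ - 1)⁻¹) ^ p := rfl
  rw [hA]
  rcases Nat.eq_zero_or_pos m with rfl | hm
  · rw [Nat.cast_zero, Real.zero_rpow (by linarith), zero_mul]; positivity
  have hm1 : (1 : ℝ) ≤ m := by exact_mod_cast hm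
  -- `mⁿ ≤ mᵖ` and `Ωᵐ = (ρᵐ)ᵖ`, so `mⁿΩ^{-m} ≤ (m ρ^{-m})ᵖ ≤ (ρ-1)^{-p}`
  have h1 : (m : ℝ) ^ n ≤ (m : ℝ) ^ (p : ℝ) := Real.rpow_le_rpow_of_exponent_le hm1 hpn
  rw [Real.rpow_natCast] at h1
  have h2 : Ω ^ m = (ρ ^ m) ^ p := by rw [← hρpow, ← pow_mul, ← pow_mul, mul_comm]
  have h3 : (m : ℝ) * (ρ ^ m)⁻¹ ≤ (ρ - 1)⁻¹ := by
    have := natCast_le_pow_div_sub_one hρ1 m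
    rw [div_eq_mul_inv] at this
    have hρm : 0 < ρ ^ m := by positivity
    calc (m : ℝ) * (ρ ^ m)⁻¹ ≤ ρ ^ m * (ρ - 1)⁻¹ * (ρ ^ m)⁻¹ := by gcongr
      _ = (ρ - 1)⁻¹ := by field_simp
  calc (m : ℝ) ^ n * (Ω ^ m)⁻¹ ≤ (m : ℝ) ^ p * (Ω ^ m)⁻¹ := by gcongr
    _ = ((m : ℝ) * (ρ ^ m)⁻¹) ^ p := by rw [h2, mul_pow, inv_pow]
    _ ≤ ((ρ - 1)⁻¹) ^ p := pow_le_pow_left₀ (by positivity) h3 p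

/-- `A_n(Ω) ≥ 0`. [folklore] -/
theorem decayConst_nonneg {Ω : ℝ} (hΩ : 1 < Ω) (n : ℝ) : 0 ≤ decayConst Ω n := by
  unfold decayConst
  have : 1 ≤ Ω ^ (1 / (⌈n⌉₊ : ℝ)) := Real.one_le_rpow hΩ.le (by positivity)
  exact pow_nonneg (inv_nonneg.2 (by linarith)) _

namespace CutoffGbarHyp

variable {β : ℕ → ℝ} {Ω : ℝ} {k : ℕ∞} {B c : ℝ} {N : ℕ} {g₀ : ℝ} (h : CutoffGbarHyp β Ω k B c N g₀)
include h

/-- **[BBS-rg-flow, Lemma 2.1(ii)(b), (2.10)]** in the form `Ω^{-(j-k)₊}ḡ_jⁿ ≤ 4ⁿ max{1, A_n(Ω)}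
(g₀/(1+cg₀j))ⁿ` for real `n ≥ 1` and all `j` (below the cut-off by `gbar_le_of_below_cutoff`; beyond
it the geometric weight beats the polynomial loss `((1+cg₀j)/(1+cg₀(k+1)))ⁿ ≤ (j-k)ⁿ`). Extra
smallness: `cg₀ ≤ 1/4`, `2N(2B+c)g₀ ≤ 1/2`. [cite: BauerschmidtBrydgesSlade2015Flow, Lemma 2.1(ii)(b), (2.10) and its proof] -/
theorem weight_mul_gbar_rpow_le (hc : c * g₀ ≤ 1 / 4) (hsmall3 : 2 * N * (2 * B + c) * g₀ ≤ 1 / 2)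
    {n : ℝ} (hn : 1 ≤ n) (j : ℕ) :
    cutoffWeight Ω k j * gbar β g₀ j ^ n ≤
      4 ^ n * max 1 (decayConst Ω n) * (g₀ / (1 + c * g₀ * j)) ^ n := by
  have hΩ := h.one_lt; have hg₀ := h.g₀_pos; have hcp := h.c_pos
  have hn0 : 0 ≤ n := by linarith
  set q : ℕ → ℝ := fun i => g₀ / (1 + c * g₀ * i) with hq
  have hq0 : ∀ i, 0 < q i := fun i => by simp only [hq]; positivity
  have hw1 := h.weight_le_one j; have hw0 := h.weight_pos j
  have hA1 : 1 ≤ max 1 (decayConst Ω n) := le_max_left _ _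
  have h2le4 : (2 : ℝ) ^ n ≤ 4 ^ n := Real.rpow_le_rpow (by norm_num) (by norm_num) hn0
  by_cases hbelow : ∀ l < j, (l : ℕ∞) ≤ k
  · -- below the cut-off
    have hg := h.gbar_le_of_below_cutoff hc hsmall3 j hbelow
    have hgpos := h.gbar_pos j
    calc cutoffWeight Ω k j * gbar β g₀ j ^ n ≤ 1 * (2 * q j) ^ n :=
          mul_le_mul hw1 (Real.rpow_le_rpow hgpos.le hg hn0) (by positivity) zero_le_one
      _ = 2 ^ n * 1 * q j ^ n := by rw [one_mul, Real.mul_rpow (by norm_num) (hq0 j).le, mul_one]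
      _ ≤ 4 ^ n * max 1 (decayConst Ω n) * q j ^ n := by
          gcongr
  · -- beyond the cut-off: `k = k₀ < ∞` and `j = k₀ + 1 + i`
    simp only [not_forall, not_le, exists_prop] at hbelow
    obtain ⟨l, hlj, hkl⟩ := hbelow
    induction k with
    | top => exact absurd le_top (not_le.2 hkl)
    | coe k₀ =>
      have hk₀l : k₀ < l := by exact_mod_cast hkl
      obtain ⟨i, rfl⟩ : ∃ i, j = k₀ + 1 + i := ⟨j - (k₀ + 1), by omega⟩
      -- the flow at the last scale below the cut-off
      have hbase : gbar β g₀ (k₀ + 1) ≤ 2 * q (k₀ + 1) := by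
        have := h.gbar_le_of_below_cutoff hc hsmall3 (k₀ + 1) fun l hl => by
          exact_mod_cast Nat.lt_succ_iff.1 hl
        simpa [hq] using this
      have hmono : gbar β g₀ (k₀ + 1 + i) ≤ 2 * gbar β g₀ (k₀ + 1) := h.gbar_le_two_mul (by omega)
      -- `q_{k₀+1} ≤ (1+i) q_j`
      have hqq : q (k₀ + 1) ≤ (1 + i) * q (k₀ + 1 + i) := by
        simp only [hq]
        rw [mul_div_assoc', div_le_div_iff₀ (by positivity) (by positivity)]
        have hcg : c * g₀ ≤ 1 := by linarith
        have : (1 : ℝ) + c * g₀ * ((k₀ + 1 + i : ℕ) : ℝ) ≤ (1 + i) * (1 + c * g₀ * ((k₀ + 1 : ℕ) : ℝ)) := by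
          push_cast
          nlinarith [mul_nonneg (mul_nonneg hcp.le hg₀.le) (Nat.cast_nonneg (α := ℝ) k₀),
            Nat.cast_nonneg (α := ℝ) i, mul_nonneg (Nat.cast_nonneg (α := ℝ) i)
              (mul_nonneg (mul_nonneg hcp.le hg₀.le) (Nat.cast_nonneg (α := ℝ) k₀))]
        nlinarith [hg₀]
      have hgj : gbar β g₀ (k₀ + 1 + i) ≤ 4 * ((1 + i) * q (k₀ + 1 + i)) := by
        nlinarith [hq0 (k₀ + 1 + i)]
      have hgjpos := h.gbar_pos (k₀ + 1 + i)
      -- the weight: `Ω^{-(1+i)}`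
      have hw : cutoffWeight Ω (k₀ : ℕ∞) (k₀ + 1 + i) = (Ω ^ (1 + i))⁻¹ := by
        rw [cutoffWeight_coe]; congr 2; omega
      have hdec := rpow_mul_inv_pow_le_decayConst hΩ hn (1 + i)
      push_cast at hdec
      calc cutoffWeight Ω (k₀ : ℕ∞) (k₀ + 1 + i) * gbar β g₀ (k₀ + 1 + i) ^ n
          ≤ (Ω ^ (1 + i))⁻¹ * (4 * ((1 + i) * q (k₀ + 1 + i))) ^ n := by
            rw [hw]
            exact mul_le_mul_of_nonneg_left (Real.rpow_le_rpow hgjpos.le hgj hn0) (by positivity)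
        _ = 4 ^ n * (((1 : ℝ) + i) ^ n * (Ω ^ (1 + i))⁻¹) * q (k₀ + 1 + i) ^ n := by
            rw [Real.mul_rpow (by norm_num) (by positivity), Real.mul_rpow (by positivity) (hq0 _).le]
            ring
        _ ≤ 4 ^ n * max 1 (decayConst Ω n) * q (k₀ + 1 + i) ^ n := by
            gcongr
            exact hdec.trans (le_max_right _ _)

/-- `g₀/(1 + cg₀j) ≤ max{1, c⁻¹} · g₀/(1 + g₀j)`. [cite: BauerschmidtBrydgesSlade2015Flow, Lemma 2.1(ii)(b) (ĝ_j ∼ ĝ₀/(1+cĝ₀j) versus (2.10))] -/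
theorem div_one_add_le (j : ℕ) : g₀ / (1 + c * g₀ * j) ≤ max 1 c⁻¹ * (g₀ / (1 + g₀ * j)) := by
  have hg₀ := h.g₀_pos; have hcp := h.c_pos
  have hj : (0 : ℝ) ≤ j := Nat.cast_nonneg j
  rw [mul_div_assoc', div_le_div_iff₀ (by positivity) (by positivity)]
  rcases le_or_gt 1 c with hc1 | hc1
  · have hm : max 1 c⁻¹ = 1 := max_eq_left (inv_le_one_of_one_le₀ hc1)
    rw [hm]
    nlinarith [mul_nonneg (mul_nonneg hg₀.le (mul_nonneg hg₀.le hj)) (sub_nonneg.2 hc1)]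
  · have hm : max 1 c⁻¹ = c⁻¹ := max_eq_right (one_le_inv_iff₀.2 ⟨hcp, hc1.le⟩)
    rw [hm]
    have : c⁻¹ * g₀ * (1 + c * g₀ * j) = g₀ * (c⁻¹ + g₀ * j) := by field_simp
    rw [this]
    have : 1 ≤ c⁻¹ := one_le_inv_iff₀.2 ⟨hcp, hc1.le⟩
    nlinarith [mul_nonneg hg₀.le hj]

/-- **[BBS-rg-flow, Lemma 2.1(ii)(b), (2.10)]** as printed: `χ_jḡ_jⁿ ≤ C_n (ḡ₀/(1 + ḡ₀j))ⁿ` for real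
`n ≥ 1` and all `j`, with `C_n = 4ⁿ max{1, A_n(Ω)} max{1, c⁻¹}ⁿ` depending only on `n, Ω, c`.
[cite: BauerschmidtBrydgesSlade2015Flow, Lemma 2.1(ii)(b), (2.10)] [cite: BauerschmidtBrydgesSlade2015LogCorr, Proposition 6.1.1 (first estimate)] -/
theorem chi_mul_gbar_rpow_le (hc : c * g₀ ≤ 1 / 4) (hsmall3 : 2 * N * (2 * B + c) * g₀ ≤ 1 / 2)
    {n : ℝ} (hn : 1 ≤ n) (j : ℕ) :
    cutoffWeight Ω k j * gbar β g₀ j ^ n ≤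
      4 ^ n * max 1 (decayConst Ω n) * (max 1 c⁻¹) ^ n * (g₀ / (1 + g₀ * j)) ^ n := by
  have hn0 : 0 ≤ n := by linarith
  have hg₀ := h.g₀_pos; have hcp := h.c_pos
  have h1 := h.weight_mul_gbar_rpow_le hc hsmall3 hn j
  have h2 := h.div_one_add_le j
  have hq0 : 0 ≤ g₀ / (1 + c * g₀ * j) := by positivity
  calc _ ≤ 4 ^ n * max 1 (decayConst Ω n) * (g₀ / (1 + c * g₀ * j)) ^ n := h1
    _ ≤ 4 ^ n * max 1 (decayConst Ω n) * (max 1 c⁻¹ * (g₀ / (1 + g₀ * j))) ^ n := by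
        gcongr
    _ = _ := by rw [Real.mul_rpow (by positivity) (by positivity)]; ring

end CutoffGbarHyp


end CTWSAW

end Literature.Barriers.CriticalPhenomena
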